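import Mathlib
import HarnessLib
import HarnessLib.Audit
import Summits.NavierStokesRegularity.Statement
import Literature.Analysis.FluidPDE.TaoAveragedSobolev
import Literature.Analysis.FluidPDE.ClassicalSolution
import Literature.Analysis.FluidPDE.LerayHopf
import Literature.Analysis.FluidPDE.SuitableWeak
import Literature.Analysis.FluidPDE.NSWave0
import Summits.NavierStokesRegularity.NavierStokesRegularity.Theorems.TypeICertificateLadderNoBlowupToClay

/-!
Route: PerpetualPump

CLOSED (refuted) 2026-08-16T20:05:43Z by planner-rfix-NavierStokesRegularity-Perpetua-458495f3-0 — reason: refuted:stmt-NavierStokesRegularity-1832 (Thesis) by Summit.NavierStokesRegularity.NavierStokesRegularity.Theorems.not_Thesis — note: KILL CRITERION FIRED (designed endgame). Thesis (stmt-1832, the closes hypothesis) refuted-substantive by Theorems.not_Thesis (p123805, PerpetualPumpThesisRefutation.lean @6e758845615f; axioms re-checked clean); witness = crux #3 AveragedTypeIBlowup PROVED (AveragedTypeIBlowup_of: m=2 seeded graded . The file is kept as the record of this route; refuted decls are indexed as negative knowledge (`ledger negatives`).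

Card realised: NavierStokesRegularity/NavierStokesRegularity/perpetual-pumps-abstract-liouville
("Perpetual pumps or abstract Liouville: does Type-I exclusion survive Tao's averaging?"). A
TWO-SIDED DICHOTOMY ROUTE — read POLARITY before the cruxes.
X ("it suffices to show") = Thesis ∧ EulerTypeIGlue ∧ NoTypeII — exactly the hypotheses of the
certified deciding theorem `closes : Thesis → EulerTypeIGlue → NoTypeII → NavierStokesRegularity`
(rev 4, native OK; the proved support NoBlowupToClay is used inside). Thesis = ABSTRACT TYPE-I
EXCLUSION at the L^∞-rate tier: for EVERY symmetric averaging datum 𝒜 with cancellation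
(Tao2016AveragedNS (1.12)–(1.16); tree `Literature.Analysis.FluidPDE.Tao2016.AveragingDatum`, the
honest L²/H¹⁰_df class, which contains the Euler operator itself: `AveragingDatum.euler_form`) and
every Schwartz divergence-free datum, an H¹⁰_df mild solution on [0,T) with ‖u(t)‖_∞ ≤ M(T−t)^{-1/2}
extends as a mild solution past T. It is Tao's open question, typed: arXiv:1402.0290 p.8 + footnote
(verified verbatim this session, held text p0008) — "it is not obvious to the author whether the
main results in [ESS] extend to averaged Navier-Stokes equations … the results in [ESS] rule out
'Type I' blowup". EulerTypeIGlue (stmt-1838, provable-L, nine toolkit files landed) carries Thesis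
to 'no Type-I blow-up in the Clay class'; NoTypeII is the shared open half stmt-0056.
POLARITY (machine facts first). (1) Thesis is STRONGER than forward Type-I exclusion for the true
Navier–Stokes equations: kernel-checked
`Theorems.AveragedTypeIBlowup.Negative.averagedTypeIBlowup_iff_not_thesis`,
`nsTypeI_extends_of_not_averagedTypeIBlowup`, `noTypeIClassical_of_not_averagedTypeIBlowup`
(NSReduction.lean, p73518). The route therefore does NOT claim Thesis is easier to PROVE than the
KNSS/Liouville tier (`Literature.Analysis.FluidPDE.LiouvilleConjectureNS`). (2) The card PREDICTS
THESIS FALSE and the board's numerics agree at coarse scale ratio: exact-looking k = 1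
discretely-self-similar Type-I THRESHOLD ORBITS of two legal autonomous Tao circuits (crux-triage
TRIAGE-r1-3 on stmt-1834: seeded graded Toda m = 2, A* = 71.130 flat over 9 scales at lam = 2,
hop-time ratios 0.5744 = lam^{-4/5} to 4 digits, clock constant M₁ = A*(q−1)/q = log(c/ε) to 0.5 %;
Tao-type m = 4 chain A* = 40.770; independent replication kit j010589; drefute one-period-map probes
j012061/j013173). (3) Hence the ranked cruxes CircuitPump (#2, deciding), AveragedTypeIBlowup (#3 =
¬Thesis by name) and PumpTransfer (#5) are the NEGATIVE programme and are 'unused' by `closes` BY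
DESIGN: they DECIDE the closes hypothesis (AveragedTypeIBlowup refuted ⇒ Thesis ⇒ closes fires;
proved ⇒ ¬Thesis in two lines ⇒ route closes `refuted:Thesis` as a new barrier theorem);
CircuitTrace (#4, the ℓ³-tier calibration) is PROVED in tree
(`Theorems.PerpetualPumpCircuitTrace.CircuitTrace_of`, p82539, 2026-08-16).
WHY THIS FORM (the why-easier field, stated honestly): not easier to prove — easier to DECIDE, with
a theorem at either end. (i) NEGATIVE SIDE IS CONSTRUCTIBLE: Tao's class has exactly solvable
members — for a cascade operator (Def 3.1/(4.1), disjoint Fourier supports) the averaged PDE IS the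
circuit ODE (4.3) lifted to heat fibres (tree `modeCoeff_eq_modeScalarX`,
`modeProjection_eq_duhamelModeField`; Thm 3.2 `localCascade_isAveraged_holds` PROVED), so ¬Thesis
reduces by the landed `Theorems.Thesis.Negative.not_thesis_of_cascade` (p83406) to a
finite-dimensional threshold construction plus soft limits; for NS itself a Type-I singularity is
EQUIVALENT to an ancient Type-I Liouville counterexample that nobody can build or exclude
(AlbrittonBarker2019 arXiv:1811.00502 Thm 1.1; Rem 3.2: the sup-rate formulation is the least
structured one). (ii) POSITIVE SIDE IS ONE TERM: by the polarisation identity 2⟨B̃(u,v),u⟩ =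
−⟨B̃(u,u),v⟩ (IsSymmetric + HasCancellation + trilinearity; Lean `Polarisation.lean` rc 0,
Cruxes/Thesis/TRIAGE-r1-2) the only L^∞-hungry term of the Ḣˢ / band-energy balance is the
DILATION-MISMATCH functional; dilation-free cancelling data get small-constant Type-I exclusion and
the L²_t Ḃ⁰_{∞,∞} criterion abstractly, mod the H¹⁰ local theory (panel paper derivation,
TRIAGE-r1-2, to be Lean-checked). (iii) TIER MAP — the question lives at exactly one tier: every
subcritical rate (T−t)^{-β}, β < 1/2, and every Serrin class L^r_t L^p_x with p < ∞ is excluded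
ABSTRACTLY at the a-priori level (the H^k energy method closes without the NS top-order
cancellation; Cruxes/AveragedTypeIBlowup/Disproof.lean item 5, not yet formalised); the ℓ³ tier is
abstract at the ODE level (CircuitTrace, proved); p = ∞ is precisely where order-0 multipliers are
unbounded (Tao p.7 footnote, verified). The Type-I rate is the FIRST non-abstract tier — that
localisation is itself a product of this route.
PAYOFF EITHER WAY. Thesis TRUE ⇒ with NoTypeII, Clay (A) by a proof that uses only energy
cancellation + scaling + order-0 harmonic analysis + autonomy (a universal template). Thesis FALSE
(the bet) ⇒ the TYPE-I BARRIER THEOREM: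
`Literature.Barriers.NavierStokesRegularity.TaoAveragedBlowup` reaches the KNSS/Liouville tier, so
every Type-I-exclusion / Liouville crux on the board (routes TypeILiouville, RecurrentProfiles,
MeanFieldTypeI, ExtremalTypeIConstant, ClockStretchingLaw, DssFarFieldSlaving, ThreadingFlux,
AdaptedFrequency …) must NAME a non-abstract input (vorticity transport/stretching geometry, local
energy inequality and pressure locality, maximum principles, backward uniqueness across a parabolic
boundary, an L^∞ → Ḃ⁰_{∞,1} gain); and the pump is K1 of the open negative-side card
pump-continuation-degree (Leray–Schauder continuation of a nondegenerate pump through the class to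
the Euler form: NS has a Type-I DSS blow-up unless the branch overheats or folds).
Lean: ∀ 𝒜 : Literature.Analysis.FluidPDE.Tao2016.AveragingDatum, 𝒜.IsSymmetric → 𝒜.HasCancellation →
∀ u₀ : SchwartzMap ℝ³ ℝ³, Literature.Analysis.FluidPDE.VectorCalculus.IsDivFree ⇑u₀ → ∀ T > 0, ∀ u :
ℝ → Tao2016.L2C, 𝒜.IsMildSolution (Tao2016.schwartzL2 u₀) (Set.Ico 0 T) u → (∃ M, ∀ t ∈ Set.Ico 0 T,
eLpNorm (u t) ⊤ volume ≤ ENNReal.ofReal (M / √(T − t))) → ∃ T' > T, ∃ v, 𝒜.IsMildSolution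
(Tao2016.schwartzL2 u₀) (Set.Ico 0 T') v ∧ ∀ t ∈ Set.Ico 0 T, v t = u t.

Rationale: WHY THIS LINE. Tao's averaged blow-up (Tao2016AveragedNS Thm 1.5; tree
`Tao2016.averagedNS_blowup_holds`, PROVED) is Type II, and Tao leaves open (arXiv:1402.0290 p.8
footnote) whether Type-I exclusion survives averaging; the catalogue facet
`TruncatedDyadic.Tao2016_prop51_dss` (kernel-checked exogenous-clock Type-I/DSS witness) records
verbatim that no AUTONOMOUS ancient witness exists and that "whether averaging-insensitive but
autonomy-using arguments can exclude Type I blow-up stays open". This route makes that residue a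
typed dichotomy and now owns MECHANISM-GRADE LEVERS on both sides (all ids below are landed
proposals or crux workfiles that elaborate on the farm). NEGATIVE SIDE (deciding crux #2): (L1)
LATCH GATE + SEED CLOCK — an explicit LEGAL m = 2 circuit, the seeded graded Toda chain Ẋ₁,ₙ =
−lam^{4n/5}X₁,ₙ + c(lamⁿX₂,ₙ² − lam^{n−1}X₂,ₙ₋₁²) − ε lamⁿX₁,ₙX₂,ₙ, Ẋ₂,ₙ = −lam^{4n/5}X₂,ₙ + c
lamⁿX₂,ₙ(X₁,ₙ₊₁ − X₁,ₙ) + ε lamⁿX₁,ₙ² (Tao symmetry (4.2) + cyclic cancellation machine-checked: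
triage Toda.lean, lead's toda_isSym/toda_isCyc), whose transfer gate {X₁,ₙ, X₂,ₙ, X₁,ₙ₊₁} is the
integrable 3-mode system D' = −2cv², v' = cvD with first integral D² + 2v² (Lean-checked
`toda_gate_first_integral`, triage W.lean rc 0) ⇒ COMPLETE transfer, no Katz–Pavlović spreading; the
next bond ignites from the ε-seed after log(c/ε)/(c·B), giving the AFFINE CLOCK A ↦ q(A − M₁), q =
lam^{1/5}, M₁ = log(c/ε), with REPELLING fixed point A* = M₁q/(q−1) — the Type-I DSS pump as a
threshold object (critical-collapse dictionary, Gundlach1997: amplitude = the one unstable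
direction); numerically exact to 4 digits (TRIAGE-r1-3; replication j010589). (L2) A C⁰ EXISTENCE
ENGINE needing no hyperbolicity: phase-matched covering relation with FREE flight time on finite
truncations (clamp trick + Brouwer) → product-topology limit (Arzelà–Ascoli) → DSS unrolling by the
scaling symmetry of class (4.3); four of its five stubs are LANDED theorems
(`Theorems.PerpetualPumpCircuitPump.stub_truncatedFlow` p82473, `stub_clampCovering` p83897,
`stub_dssExtension` p84911, `stub_truncationLimit` p85365) and the composition `CircuitPump_of` is
kernel-checked modulo ONE stub, `ClockBox` (finite-time a-priori inequalities for the truncated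
circuit, uniform in the truncation level; line Cruxes/CircuitPump/Lines/singular-clock-gspt). (L3)
A-PRIORI STRUCTURE from the standing disprover, landed under Theorems/CircuitPump/Negative: energy
conservation is load-bearing (`nonConservativePump`: an explicit non-conservative 1-DSS Type-I
ancient pump at lam = 2^{5/4}, p83560), Type I self-improves to critical boundedness
(`typeI_critical_bound`, p77762), witnesses have bi-infinite support and m = 1 witnesses are
sign-definite (p74927, p76936), small-constant Liouville C ≥ lam^{-1/5}/S_tot (Disproof.lean §b5
`typeI_const_lower_bound`). TRANSFER (#5): the ODE⇒PDE step is now EXACT, not perturbative — for a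
cascade operator the averaged PDE is the circuit lifted to heat fibres (tree
`modeCoeff_eq_modeScalarX`, `modeProjection_eq_duhamelModeField`), and
`Theorems.Thesis.Negative.not_thesis_of_cascade` (p83406) + Thm 3.2
(`localCascade_isAveraged_holds`, PROVED) reduce ¬Thesis to a cascade-level Type-I non-extendable
mild solution; what remains is ONE research stub (`stub_liftPump`: a Type-I pump of the lifted
Volterra chain on a ray; synthesis stub p87248 landed). POSITIVE SIDE (Thesis): (L4) ONE-TERM
CRITERION — polarisation 2⟨B̃(u,v),u⟩ = −⟨B̃(u,u),v⟩ (Lean, Polarisation.lean rc 0) leaves the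
DILATION-MISMATCH functional as the only L^∞-hungry term of the band-energy balance (panel paper
derivation, TRIAGE-r1-2 on stmt-1832); the lead's checked line (besov-envelope-floor) is Thesis ⇐
[H¹⁰ continuation criterion (4 local-theory stubs; weighted bilinear toolkit p88300 landed) +
one-good-time Besov Ḃ⁰_{∞,1} floor] ∧ EnvelopeUpgrade (no log-hot stack above the Type-I front —
NEW, open) ∧ NoPersistentFront (rigidity core ⊇ NS forward Type-I exclusion, the mirror of the
pump), composition `Thesis_of` proved from the stubs. (L5) TIER MAP — β < 1/2 and Serrin p < ∞ are
abstract (a-priori energy method, Cruxes/AveragedTypeIBlowup/Disproof item 5, unformalised), ℓ³ is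
abstract at the ODE level (CircuitTrace PROVED, p82539), p = ∞ is the multiplier exception (Tao p.7
fn): the Type-I rate is the first non-abstract tier. Imported areas, with dictionaries: dynamical
systems / renormalisation of shell-model blow-up (profile = fixed point or periodic orbit of the
step map: DombreGilson1998, Mailybaev2012, Mailybaev2013, CampolinaSimonnetThalabard2025),
integrable lattices (Toda/Flaschka gate inside Tao's offset set), critical collapse (Gundlach1997:
threshold solution DSS with one unstable mode ↔ Type-I pump with unstable amplitude), topological
covering relations (Zgliczyński-type isolating segments realised as clamp + Brouwer).
RANKED CRUXES. #2 CircuitPump (stmt-1834, DECIDING; ODE, Mathlib-only): for arbitrarily fine lam an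
autonomous energy-conserving Tao circuit has a nontrivial exactly-DSS, Type-I-in-time solution on
(−∞,0), all n ∈ ℤ — the perpetual pump (why it might fail: the crux needs lam ↓ 1 where the clock
margin (q−1)/4 ≈ (log lam)/20 must beat clock errors O(1/log(1/ε)) uniformly over the box and the
truncation — the content of the last stub ClockBox; any disproof must use IsCyc or fineness, since a
non-conservative pump exists at lam = 2^{5/4}; sources Tao2016AveragedNS §4–§6, TRIAGE-r1-3,
Negative/NonConservativePump). #3 AveragedTypeIBlowup (stmt-1835 = ¬Thesis by name): a Type-I-rate
non-extendable H¹⁰ mild solution of an autonomous averaged equation from Schwartz data (why it might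
fail: only if Type-I exclusion is itself abstract — ε-regularity/partial regularity IS
(Coiculescu2023AveragedPartialRegularity Thm 1.3, amenable operators, dim S_T ≤ 5−4α) and a
class-wide pile-up exclusion (L4) would make it so; lead line: exact Volterra chain + Thm 3.2,
hardest stub `stub_chain`). #4 CircuitTrace (stmt-1836): dyadic ESS — ℓ³-in-scale bounded ⇒ no
blow-up for every Tao circuit — PROVED (`CircuitTrace_of`, p82539; tightness:
`valveBudget_false_without_cyclic`, `traceEndgame_false_without_tilt`,
`quietImpliesRegular_false_without_amplitude`, `circuitTraceWithoutL3_false`, all landed under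
Theorems/CircuitTrace/Negative) — the ℓ³ tier IS abstract at the ODE level, as the route predicted.
#5 PumpTransfer (stmt-1837): CircuitPump → AveragedTypeIBlowup (why it might fail: the anonymous
CircuitPump witness carries no stability, so the honest transfer re-proves the pump for the LIFTED
chain with heat-kernel memory k_{i,n}(τ) = Re⟨e^{τΔ}ψ_{i,n},ψ_{i,n}⟩ instead of e^{−lam^{4n/5}τ}:
threshold classification for a Volterra system (`stub_liftPump`); sources Tao2016AveragedNS Def 3.1,
Thm 3.2, Lemma 4.1; AlbrittonBarker2019 (blow-down alternative)). #6 NoTypeII (stmt-0056, shared by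
20+ routes): the open Type-II half (why it might fail: a Type-II singularity from Schwartz data =
¬Clay; Tao's witness is Type II). #7 EulerTypeIGlue (stmt-1838, crux by the glue rule, provable-L):
solution-concept bookkeeping NS classical ↔ Euler-datum H¹⁰ mild (why it might fail: only by a
concept mismatch — Duhamel identity with Bochner forms, ν-scaling, mild→classical upgrade; nine
toolkit files landed; cheapest line bounded-pullback uses the PROVED
`hasSmoothExtensionPast_of_bounded_holds`). Target Thesis (stmt-1832, rank 0, auto-crux): line
besov-envelope-floor (L4), 7 stubs, lead holds NoPersistentFront. Glue supports PumpChain (14768)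
and ThesisOfNoAveragedTypeIBlowup (14796): pure logic, candidate proofs attached (refuter g48-1).
KILL CRITERIA. AveragedTypeIBlowup proved (intended: CircuitPump + PumpTransfer + PumpChain;
equivalently ¬Thesis by name via `averagedTypeIBlowup_iff_not_thesis`) ⇒ Thesis refuted ⇒ close
`refuted:Thesis` WITH CENSUS = the Type-I barrier theorem (which abstract inputs are jointly
insufficient: energy identity, scaling, order-0 harmonic analysis incl. ε-regularity, autonomy,
Serrin p < ∞; operator files it under Literature/Barriers; planners of every Liouville/Type-I route
re-price their cruxes; card pump-continuation-degree activates). A Type-II blow-up from Schwartz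
data kills NoTypeII and Clay (A) for every positive route. Thesis cannot be 'refuted cheaply'
otherwise: ¬Thesis contains NS Type-I blow-up ⇒ crux (`crux_of_nsTypeIBlowup`, Disproof) — sandwich
NS-Type-I-blow-up ⇒ ¬Thesis ⇒ ¬(abstract Liouville). WIN SIGNALS for the positive side: ¬CircuitPump
at fine lam (an ODE abstract Liouville theorem; the disprover's universal tools stop exactly at κC ≥
1, Disproof 'Why the crux resists') or EnvelopeUpgrade proved for data with dilation spread.
NOT DECOMPOSED YET. No third layer: stubs live on the crux items (D-0027 lines), not as route items.
Deliberately unfiled: the PDE-level ancient/DSS Liouville statement for 𝒜 (needs an L^∞_loc duality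
extension of 𝒜.form); nondegeneracy/Floquet theory of the pump (belongs to card
pump-continuation-degree, not to this route's closes); the abstract Serrin-ladder theorem (β < 1/2,
p < ∞: calibration like CircuitTrace, would be another crux outside the cone); the
positive-measure-singular-set companion (moot: partial regularity is abstract, Coiculescu 2023). If
CircuitPump closes: expand #5 only (lifted-chain pump ⇐ coarse-lattice certified pump + spectral-law
continuation, the two surviving triage families on stmt-1837).
CHEAPEST FALSIFIER. Of the negative programme (and so the cheapest route to the barrier theorem):
the ONE remaining finite-dimensional statement ClockBox for the seeded Toda circuit at fine lam —
kit-checkable before Lean by the drefute covering probe (phase-matched one-period map, fixed point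
(A*, env*), Jacobian count, face images; j012061/j013173 came out in favour at lam ∈ {2, 1.5, 1.25,
1.125}); a failure mode would be a chaotic/creeping edge at lam ↓ 1 (then fallback line
wire-decoupling: p-periodic graded alphabet, k·log lam = log Λ fixed, `circuitPump_of_coarseFamily`
PROVED). Of the positive thesis: already run — the threshold plateaus above ARE the cheap falsifier
of 'abstract Liouville' at the ODE level and came out against Thesis; what would falsify the BET
instead is an ODE abstract Liouville theorem at fine lam or a proof of EnvelopeUpgrade.
NUMBERS. Tao units α = 2/5: dissipation lam^{4n/5}, coupling lamⁿ, L^∞ weight lam^{3n/5}, critical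
amplitude lam^{n/5}|X|, clock ratio lam^{-4k/5}. Thresholds (TRIAGE-r1-3 v2, toys-r1-3 logs;
replication j010589): seeded Toda m = 2, c = 1: A* = 71.130 (lam 2, ε 1e-4; plateau drift 5·10⁻⁷
over 9 scales; hop ratio 0.5744 = 2^{-4/5}), 106.266 (lam 2, ε 1e-6), 122.879 (lam 1.5, ε 1e-4; 13
scales; ratio 0.7229 vs 0.7230); fitted M₁ = A*(q−1)/q = 9.208 (lam 2, ε 1e-4) | 13.756 (lam 2, ε
1e-6) | 9.571 (lam 1.5, ε 1e-4) against log(c/ε) = 9.210 | 13.816 | 9.210 (0.5 % at lam 2, +4 % at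
lam 1.5); Tao-type m = 4 mild-constant chain A* = 40.770 flat over 6 scales; 5-mode singular clock
A* = √2q/(q−1), faces [A*/2, 2A*] with exit ratios 2−q < 1 < (1+q)/2 (Lean `clock_law_faces`, triage
W.lean; `lower_face`/`upper_face` in the line skeleton). Universal lower bound for any pump: C ≥
lam^{-1/5}/S_tot (small-constant Liouville). Non-conservative closed-form pump exists iff lam^{4/5}
= 2. Tier map: β < (1−3/p)/(2(1−2/p)) ↑ 1/2 excluded abstractly for every p < ∞.
SOURCES. Held and read (lit read, this session or by the crux seats): Tao2016AveragedNS
arXiv:1402.0290 (pp.7–8 footnotes verbatim; §4 (4.1)–(4.3), Thm 3.2, Thm 4.2, §5.2 Prop 5.1, §6),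
AlbrittonBarker2019 arXiv:1811.00502 (Thm 1.1, Rem 3.2), KochNadirashviliSereginSverak2009
arXiv:0709.3599, SereginSverak2009 arXiv:0804.1803, Seregin2012 arXiv:1104.3615,
Coiculescu2023AveragedPartialRegularity arXiv:2307.15986 (Thm 1.3 p.4), BarbatoMorandinRomito2011
arXiv:1007.3401, Cheskidov2008 arXiv:math/0601074, CheskidovDaiFriedlander2023 arXiv:2209.10203,
BarbatoFlandoliMorandin arXiv:0811.1689 Thm 8, CampolinaSimonnetThalabard2025 arXiv:2501.07377,
Mailybaev2012 (arXiv:1201.1631), Mailybaev2013 arXiv:1210.2494, DombreGilson1998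
(arXiv:chao-dyn/9510009), Gundlach1997 (arXiv:gr-qc/9604019), PlechacSverak2003
(arXiv:math/0302129), ChaeWolf2017RemovingDSS (arXiv:1610.09464), CheskidovDaiPalasek2025
arXiv:2511.09556, Tao2011 arXiv:1108.1165, Palasek2026ElementaryModel arXiv:2605.13827. Cite-only
(not held, acq-00034): EscauriazaSereginSverak2003 Thms 1.3–1.4 (statement proxied by Seregin2012
Thm 1.1).

Novelty: NOVELTY (revised 2026-08-16, promote pass; route-review grade so far: new-combination, refuter
0860cd9d 2026-08-15, given BEFORE any lever existed). DELTA NOW ON THE BOARD, per lever: (L1) a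
Tao-admissible circuit chosen for an INTEGRABLE transfer gate — graded Toda/Flaschka monomials lie
in Tao's offset set S (legality Lean-checked), the gate {X₁,ₙ,X₂,ₙ,X₁,ₙ₊₁} has the first integral
D²+2v² (complete transfer, no Katz–Pavlović interference) and an ε-seed whose ignition time
log(c/ε)/(cB) IS the DSS clock: affine return map A ↦ q(A−M₁), repelling fixed point A* = M₁q/(q−1),
confirmed numerically to 0.5 % (TRIAGE-r1-3, j010589) — nobody has embedded an integrable lattice in
an averaged-NS/shell-model cascade or produced a Type-I-rate DSS THRESHOLD orbit of an autonomous
energy-conserving Tao circuit (searched, below); (L2) existence of ancient DSS objects by a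
phase-matched covering relation with FREE flight time on truncations + clamp/Brouwer +
product-topology limit + DSS unrolling (four stubs landed p82473/p83897/p84911/p85365) — a C⁰ engine
that sidesteps the missing hyperbolicity/GSPT and the non-compactness of the renormalisation map;
(L3) kernel-checked a-priori structure of pumps: energy conservation load-bearing (explicit
non-conservative pump at lam = 2^{5/4}), Type-I ⇒ critically bounded, small-constant Liouville C ≥
lam^{-1/5}/S_tot; (L4) on the positive side the polarisation identity 2⟨B̃(u,v),u⟩ = −⟨B̃(u,u),v⟩
(Lean) reduces abstract Type-I exclusion to ONE L^∞-h  [refs: 1402.0290, 2307.15986, 1811.00502, 1007.3401, math/0601074, 0811.1689, 1201.1631, 1210.2494, 2501.07377, chao-dyn/9510009, gr-qc/9604019, math/0302129, 1610.09464, 2511.09556, arxiv:1402.0290, CheskidovDaiFriedlander2023, AlbrittonBarker2019, Cheskidov2008, Mailybaev2012, Mailybaev2013, CampolinaSimonnetThalabard2025, DombreGilson1998, Gundlach1997, PlechacSverak2003, ChaeWolf2017, Tsai1998, Necas]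

Barriers (technique_class: liouville-rigidity type-I-blowup-rate type-I-exclusion): - technique_class: liouville-rigidity type-I-blowup-rate type-I-exclusion; negative side:
renormalisation-fixed-point covering-relation integrable-anchor
BARRIER LOGIC OF A DICHOTOMY ROUTE: a proof of Thesis is by definition an ABSTRACT argument (it
quantifies over Tao's whole class), so every abstract-class barrier below must be MET, not evaded —
possible only where these barriers leave an opening: their witnesses are all Type II /
non-conservative / non-autonomous / non-solenoidal. The negative programme (CircuitPump →
PumpTransfer → AveragedTypeIBlowup) would CLOSE that opening. Per entry, the hypothesis of the
barrier theorem that Thesis escapes (or does not):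
- Literature.Barriers.NavierStokesRegularity.TaoAveragedBlowup (technique_class energy-identity /
harmonic-analysis / abstract-bilinear-estimates): escaping hypothesis = the RATE — Tao's witness is
Type II (p.8 footnote, verified; tree `averagedNS_blowup_holds`), Thesis only speaks about
Type-I-rate solutions, so no contradiction; conversely AveragedTypeIBlowup is exactly this barrier's
Type-I strengthening. The positive assembly uses Thesis only with NoTypeII, which this barrier
already forces to be fine-structure (as route TypeILiouville records).
- Literature.Barriers.NavierStokesRegularity.TruncatedDyadicBlowup (Tao's truncated dyadic Type-II
blow-up; time-dependence-insensitive energy arguments fail): escaping hypothesis = the RATE again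
(its witness is Type II, `critical_blowup`); relation as for TaoAveragedBl

Novelty grade: new-combination — Route review grade (refuter 0860cd9d, 2026-08-15). Search this session: searchd DOWN (rc 75); galaxy bm25 --star pdf 'Type I self-similar blow-up averaged Navier–Stokes / autonomous dyadic shell model / DSS ancient cascade' (15 rows: CampolinaSimonnetThalabard2025, Cheskidov2008 TAMS, Cheskidov–Shvy (refuter refuter-rreview-route-HubbardSuperconduc-0860cd9d-0, 2026-08-15T12:15:33Z; prior: arXiv:1402.0290 Tao2016AveragedNS §1.1 p.8 footnote (Type-I/ESS question for averaged NS posed, open), §5.2 Prop 5.1 (exogenous-clock Type-I-rate witness; tree facet TruncatedDyadicTypeIBlowup), doi:10.1090/S0002-9947-08-04494-2 Cheskidov2008 (dyadic blow-up γ<1/3) / BarbatoMorandinRomito2011 (scalar non-negative regularity; catalogue DyadicCascadeRegularity), doi:10.1103/physreve.85.066317 Mailyb)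

History (route lifecycle, newest last):
- 2026-08-16T04:12:47Z · AUTO-CRUX (backfill): Thesis — hypotheses of the deciding theorem that nothing in the route derives are cruxes (operator:999:1085951)
- 2026-08-16T06:33:32Z · rev 3: dropped ThesisIffNoAveragedTypeIBlowup — route-repair (unused-crux, planner e25cecf4): 3 glued / 0 cruxes dropped. The 'unused' cruxes CircuitPump (#2, 1834), AveragedTypeIBlowup (#3, 1835), PumpTransf (planner-rrepair-NavierStokesRegularity-Perpetu-e25cecf4-0)
- 2026-08-16T19:57:31Z · BROKEN — Thesis (stmt-NavierStokesRegularity-1832, crux) refuted by Summit.NavierStokesRegularity.NavierStokesRegularity.Theorems.not_Thesis @ 6e758845615f (prover-line-stmt-NavierStokesRegularity-1832-0)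
- 2026-08-16T20:05:43Z · CLOSED refuted — refuted:stmt-NavierStokesRegularity-1832 (Thesis) by Summit.NavierStokesRegularity.NavierStokesRegularity.Theorems.not_Thesis (planner-rfix-NavierStokesRegularity-Perpetua-458495f3-0)

sub-problem: NavierStokesRegularity · status: closed(refuted) · opened planner-plancard-NavierStokesRegularity-Navie-286aaa38-0 2026-08-15T10:59:07Z · rev 6 · ledger route-NavierStokesRegularity-PerpetualPump
GENERATED by the gate from the ledger (D-0016/17). Provers cite these decls: `theorem foo : Summit.NavierStokesRegularity.NavierStokesRegularity.Theses.PerpetualPump.<Decl> := …` in Summits/NavierStokesRegularity/NavierStokesRegularity/Theorems/<Name>.lean.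
-/

namespace Summit.NavierStokesRegularity.NavierStokesRegularity.Theses.PerpetualPump

open scoped BigOperators Topology Manifold Classical MeasureTheory ProbabilityTheory Matrix InnerProductSpace ComplexConjugate ContinuousMap
open Filter Set Function TopologicalSpace MeasureTheory

attribute [summit_statement] _root_.NavierStokesRegularity

open Literature.NS

/-- item stmt-NavierStokesRegularity-1832 · crux (kind.auto-crux: conjecture-grade) · rank 0 · closed · refuted by Summit.NavierStokesRegularity.NavierStokesRegularity.Theorems.not_Thesis @ 6e758845615f (prover) · by planner
why it might fail: Predicted FALSE: CircuitPump+PumpTransfer give a Type-I blow-up of an autonomous averaged NS (k=1 DSS Type-I threshold orbits seen numerically at lam=2,1.5); if TRUE it contains NS Type-I exclusion (NSReduction), so only a class-wide no-pile-up lemma for the dilation-mismatch term can prove it.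
sources: Tao2016AveragedNS arXiv:1402.0290 §1.1 p.8 fn (question posed; Type II witness), p.7 fn (endpoint spaces), Thm 1.5, Thm 3.2, Theorems/AveragedTypeIBlowup/Negative/NSReduction.lean p73518 (averagedTypeIBlowup_iff_not_thesis, nsTypeI_extends_of_not_averagedTypeIBlowup, noTypeIClassical_of_not_averagedTypeIBlowup), Cruxes/Thesis/TRIAGE-r1-2.md panel sharpening + Polarisation.lean rc0 (one-term criterion); Cruxes/Thesis/PICKED.md (line besov-envelope-floor, 7 stubs; p88300), Cruxes/CircuitPump/TRIAGE-r1-3.md §Toy A/B (A*=71.130@lam2, 122.879@lam1.5, 40.770 Tao-type); kit j010589, AlbrittonBarker2019 arXiv:1811.00502 Thm 1.1, Rem 3.2, KochNadirashviliSereginSverak2009 arXiv:0709.3599 §1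
[target] ABSTRACT TYPE-I EXCLUSION (AbsX; card perpetual-pumps-abstract-liouville, branch (AbsL) in
its forward finite-energy face): for every symmetric averaging datum 𝒜 with cancellation
(Tao2016AveragedNS (1.12)-(1.16); Literature.Analysis.FluidPDE.Tao2016.AveragingDatum — the honest
L² class, NOT the deprecated function-level IsAveragedEulerBilinear) and every Schwartz
divergence-free u₀, an H¹⁰_df mild solution on [0,T) (Tao (1.15)) with ‖u(t)‖_∞ ≤ M(T−t)^{-1/2}
extends as a mild solution past T. Contains, via the Euler datum (AveragingDatum.euler_form) and
ν-scaling, 'no Type-I blow-up for NS from Clay data' (support EulerTypeIGlue), hence with NoTypeII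
(stmt-0056) and NoBlowupToClay (stmt-0055) gives Clay (A) (Assembly, pure logic). Tier (a) of the
route (L^∞-rate); the L³ tier of Tao's footnote is NOT this statement (see CircuitTrace). The card
predicts this is FALSE: its constructive negation is crux AveragedTypeIBlowup; ¬Thesis follows from
it in two lines (Sketch.lean not_thesis_of_blowup). [sources: Tao2016AveragedNS §1.1 p.8 + footnote,
(1.15), Thm 1.5; KochNadirashviliSereginSverak2009 §1; AlbrittonBarker2019 Thm 1.1;
EscauriazaSereginSverak2003] -/
@[route_item "route-NavierStokesRegularity-PerpetualPump"]
def Thesis : Prop :=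
  ∀ 𝒜 : Literature.Analysis.FluidPDE.Tao2016.AveragingDatum, 𝒜.IsSymmetric → 𝒜.HasCancellation → ∀ u₀ : SchwartzMap (EuclideanSpace ℝ (Fin 3)) (EuclideanSpace ℝ (Fin 3)), Literature.Analysis.FluidPDE.VectorCalculus.IsDivFree ⇑u₀ → ∀ T : ℝ, 0 < T → ∀ u : ℝ → Literature.Analysis.FluidPDE.Tao2016.L2C, 𝒜.IsMildSolution (Literature.Analysis.FluidPDE.Tao2016.schwartzL2 u₀) (Set.Ico 0 T) u → (∃ M : ℝ, ∀ t ∈ Set.Ico 0 T, MeasureTheory.eLpNorm (u t) ⊤ MeasureTheory.volume ≤ ENNReal.ofReal (M / Real.sqrt (T - t))) → ∃ T' : ℝ, T < T' ∧ ∃ v : ℝ → Literature.Analysis.FluidPDE.Tao2016.L2C, 𝒜.IsMildSolution (Literature.Analysis.FluidPDE.Tao2016.schwartzL2 u₀) (Set.Ico 0 T') v ∧ ∀ t ∈ Set.Ico 0 T, v t = u t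

/-- item stmt-NavierStokesRegularity-1834 · crux · rank 2 · closed · proved by Summit.NavierStokesRegularity.NavierStokesRegularity.Theorems.PerpetualPumpCircuitPump.CircuitPump_proof @ aee7b8af3d14 (prover) · by planner
why it might fail: Needs lam↓1: covering margin (q−1)/4≈(log lam)/20 vs clock errors O(1/log(1/ε)), uniform over box and truncation = stub ClockBox (last of 5; 4 landed); a creeping/chaotic edge at fine lam kills k=1 DSS; any disproof must use IsCyc (non-conservative pump exists at lam=2^{5/4}) or fineness.
sources: Tao2016AveragedNS arXiv:1402.0290 §4 (4.1)-(4.3), Thm 4.2, §5.2 Prop 5.1, §6 Table 1, Cruxes/CircuitPump/Lines/singular-clock-gspt.lean+.md (CircuitPump_of by name); landed stubs Theorems/PerpetualPumpCircuitPump{TruncatedFlow p82473, ClampCovering p83897, DssExtension p84911, TruncationLimit p85365}, Cruxes/CircuitPump/TRIAGE-r1-3.md (seeded graded Toda m=2: A*=71.130@lam2 eps1e-4 over 9 scales, hop ratio lam^-4/5 to 4 digits; M1=log(c/eps) to 0.5%); kit j010589 (replication), j012061/j013173 (drefute covering probe), Theorems/CircuitPump/Negative/{LoadBearing p73137, WitnessStructure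 p74927, CriticalBoundRoundOne p76401, ScalarSign p76936, CriticalBound p77762, NonConservativePump p83560}; Cruxes/CircuitPump/Disproof.lean §b5 (small-constant Liouville), Literature.Barriers.NavierStokesRegularity.TruncatedDyadicTypeIBlowup (TruncatedDyadic.Tao2016_prop51_dss; scope_caveats (ii): no ancient witness), BarbatoMorandinRomito2011 arXiv:1007.3401 Thm 1 (=DyadicCascadeRegularity); Cheskidov2008 arXiv:math/0601074 Thm 4.4, 5.3; BarbatoFlandoliMorandin arXiv:0811.1689 Thm 8
[crux] THE DYADIC PERPETUAL PUMP (card P1+P3 at the ODE level; Mathlib-only, honest). For every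
lam₀>1 there are lam ∈ (1,lam₀) (arbitrarily FINE scale ratio, as needed by Tao's Thm 3.2 embedding,
lam = (1+ε₀)^{5/2}), a number m of modes per scale, real structure constants coeff : Fin m³ × S → ℝ
on Tao's offset set S = {(0,0,0),(1,0,0),(0,1,0),(0,0,1)} (labelled Option (Fin 3)) obeying Tao's
symmetry (4.2) and cyclic cancellation (cyclic) — i.e. exactly the autonomous viscous circuit class
of Tao2016AveragedNS (4.3) with α = 2/5: Ẋ_{i,n} = −lam^{4n/5}X_{i,n} + Σ coeff(i₁,i₂,i,μ)
lam^{n−μ₃} X_{i₁,n−μ₃+μ₁}X_{i₂,n−μ₃+μ₂} — a period k ≥ 1 and X : Fin m → ℤ → (−∞,0) → ℝ solving the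
system for ALL n ∈ ℤ and t<0, which is (i) EXACTLY DISCRETELY SELF-SIMILAR, X_{i,n+k}(lam^{−4k/5}t)
= lam^{−k/5}X_{i,n}(t) (invariance under the scaling X_{i,n}(t) ↦ lam^{k/5}X_{i,n+k}(lam^{−4k/5}t)
of (4.3)), (ii) TYPE I in time, lam^{3n/5}|X_{i,n}(t)| ≤ C/√(−t) (the L^∞ weight N_n^{3/2} =
lam^{3n/5}; KNSS (1.4)), (iii) nontrivial. An ancient, infinite-energy, critically bounded cascade
fed from n = −∞ ('perpetual pump'); in the §1.2 dictionary |u| ~ 1/(|x|+√−t), the Tsai/Bradshaw–Tsai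
Type-I DSS profile cla -/
@[route_item "route-NavierStokesRegularity-PerpetualPump"]
def CircuitPump : Prop :=
  ∀ lam₀ : ℝ, 1 < lam₀ → ∃ lam : ℝ, 1 < lam ∧ lam < lam₀ ∧ ∃ (m : ℕ) (coeff : Fin m → Fin m → Fin m → Option (Fin 3) → ℝ) (k : ℕ) (X : Fin m → ℤ → ℝ → ℝ), let F : Fin m → ℤ → ℝ → ℝ := fun (i : Fin m) (n : ℤ) (t : ℝ) => -(lam ^ ((4 / 5 : ℝ) * n)) * X i n t + ∑ i₁ : Fin m, ∑ i₂ : Fin m, ∑ μ : Option (Fin 3), coeff i₁ i₂ i μ * lam ^ ((n : ℝ) - (if μ = some 2 then 1 else 0)) * X i₁ (n + ((if μ = some 0 then 1 else 0) - (if μ = some 2 then 1 else 0))) t * X i₂ (n + ((if μ = some 1 then 1 else 0) - (if μ = some 2 then 1 else 0))) t; (∀ (i₁ i₂ i₃ : Fin m) (μ : Option (Fin 3)), coeff i₁ i₂ i₃ μ = coeff i₂ i₁ i₃ (Option.map (Equiv.swap (0 : Fin 3) 1) μ)) ∧ (∀ (v : Fin 3 → Fin m) (μ : Option (Fin 3)),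 ∑ σ : Equiv.Perm (Fin 3), coeff (v (σ 0)) (v (σ 1)) (v (σ 2)) (Option.map σ.symm μ) = 0) ∧ 1 ≤ k ∧ (∀ (i : Fin m) (n : ℤ) (t : ℝ), t < 0 → HasDerivAt (X i n) (F i n t) t) ∧ (∀ (i : Fin m) (n : ℤ) (t : ℝ), t < 0 → X i (n + k) (lam ^ (-((4 / 5 : ℝ) * k)) * t) = lam ^ (-((1 / 5 : ℝ) * k)) * X i n t) ∧ (∃ C : ℝ, ∀ (i : Fin m) (n : ℤ) (t : ℝ), t < 0 → lam ^ ((3 / 5 : ℝ) * n) * |X i n t| ≤ C / Real.sqrt (-t)) ∧ (∃ (i : Fin m) (n : ℤ) (t : ℝ), t < 0 ∧ X i n t ≠ 0)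

/-- item stmt-NavierStokesRegularity-1835 · crux · rank 3 · closed · proved by Summit.NavierStokesRegularity.NavierStokesRegularity.Theorems.PerpetualPumpAveragedTypeIBlowup.AveragedTypeIBlowup_of @ 124e2660af92 (prover) · by planner
why it might fail: False iff Type-I exclusion is abstract: partial regularity IS (Coiculescu Thm 1.3) and a class-wide no-pile-up lemma for the dilation-mismatch term would suffice. Else it needs the pump of the EXACTLY lifted chain (heat-kernel memory): threshold excursions may break fire-or-die pinning (stub_chain).
sources: Tao2016AveragedNS arXiv:1402.0290 Thm 1.5, Def 3.1, Thm 3.2, Lemma 4.1, §5.2 Prop 5.1 + p.26, Theorems/Thesis/Negative/CascadeReduction.lean not_thesis_of_cascade p83406; Theorems/AveragedTypeIBlowup/Negative/{NSReduction p73518, SymmetryRedundant p73952, UniformDampingConjugacy p76906}, Cruxes/AveragedTypeIBlowup/Disproof.lean items 2, 5 (Serrin p<∞ and beta<1/2 abstract; beta=1/2 first non-abstract tier), 6 (literature sweep); PICKED.md (threshold line: exact Volterra chain + Thm 3.2, 7 stubs), Coiculescu2023AveragedPartialRegularity arXiv:2307.15986 Thm 1.3, AlbrittonBarker2019 arXiv:1811.00502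 Thm 1.1 (blow-down alternative), Rem 3.2, PlechacSverak2003 arXiv:math/0302129 (NS-type system with energy identity: self-similar singularities only n>4)
[crux] THE PDE PERPETUAL PUMP, forward finite-energy face (card branch (Pump); constructive
¬Thesis): there exist a symmetric averaging datum 𝒜 with cancellation (Tao2016.AveragingDatum), a
Schwartz divergence-free u₀, T>0 and an H¹⁰_df mild solution u on [0,T) with the Type-I rate
‖u(t)‖_∞ ≤ M(T−t)^{-1/2} and NO mild extension past T agreeing with u on [0,T) (so ‖u(t)‖_{H¹⁰} → ∞:
a Type-I blow-up of an AUTONOMOUS averaged Navier–Stokes equation = 'Theorem 1.5 at the Type-I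
rate'). Intended proof: CircuitPump + PumpTransfer (truncate the ancient DSS chain to n ≥ n₀ with
datum on the orbit, embed by Tao Thm 3.2, control Lemma 4.1 errors by structural stability). Value
if proved: a NEW BARRIER THEOREM — KNSS (L) (Literature.Analysis.FluidPDE.LiouvilleConjectureNS),
Tsai's TypeIDSSLiouvilleConjecture, Seregin–Šverák Type-I exclusion cannot be proved by any argument
treating B abstractly (energy identity + order-0 harmonic analysis + scaling + autonomy +
compactness); every Liouville crux on the board (TypeILiouville #3/#4, DssFarFieldSlaving H1, Blowup
#5) must then name its fine-structure input (vorticity equation, local energy inequality, maximum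
principles, backward uniqueness). No -/
@[route_item "route-NavierStokesRegularity-PerpetualPump"]
def AveragedTypeIBlowup : Prop :=
  ∃ 𝒜 : Literature.Analysis.FluidPDE.Tao2016.AveragingDatum, 𝒜.IsSymmetric ∧ 𝒜.HasCancellation ∧ ∃ u₀ : SchwartzMap (EuclideanSpace ℝ (Fin 3)) (EuclideanSpace ℝ (Fin 3)), Literature.Analysis.FluidPDE.VectorCalculus.IsDivFree ⇑u₀ ∧ ∃ T : ℝ, 0 < T ∧ ∃ u : ℝ → Literature.Analysis.FluidPDE.Tao2016.L2C, 𝒜.IsMildSolution (Literature.Analysis.FluidPDE.Tao2016.schwartzL2 u₀) (Set.Ico 0 T) u ∧ (∃ M : ℝ, ∀ t ∈ Set.Ico 0 T, MeasureTheory.eLpNorm (u t) ⊤ MeasureTheory.volume ≤ ENNReal.ofReal (M / Real.sqrt (T - t))) ∧ ¬ ∃ T' : ℝ, T < T' ∧ ∃ v : ℝ → Literature.Analysis.FluidPDE.Tao2016.L2C, 𝒜.IsMildSolution (Literature.Analysis.FluidPDE.Tao2016.schwartzL2 u₀) (Set.Ico 0 T') v ∧ ∀ t ∈ Set.Ico 0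 T, v t = u t

/-- item stmt-NavierStokesRegularity-1836 · crux · rank 4 · closed · proved by Summit.NavierStokesRegularity.NavierStokesRegularity.Theorems.PerpetualPumpCircuitTrace.CircuitTrace_of @ cf29ad9b5131 (prover) · by planner
why it might fail: PROVED in tree 2026-08-16: Theorems/PerpetualPumpCircuitTrace.lean CircuitTrace_of (p82539; stubs p77823 p76559 p77460 p77067 p76417 p76661). Tightness: IsCyclic, the amplitude hypothesis, tilt β>1/5 and the ℓ³ bound are each load-bearing (Negative lane). Awaits gate/prover item close.
sources: Theorems/PerpetualPumpCircuitTrace.lean (CircuitTrace_of, p82539) + six stub files PerpetualPumpCircuitTrace{ValveBudget p77823, BlockStaysQuiet p76559, QuietImpliesRegular p77460, TiltedGronwall p77067, TerminalTrace p76417, TraceEndgame p76661}, Theorems/CircuitTrace/Negative/{ValveBudgetNeedsCyclic (valveBudget_false_without_cyclic), QuietRegularNeedsAmplitude, TraceEndgameNeedsTilt, TaoBridge (circuitTraceWithoutL3_false), LoadBearing, Structure}, Tao2016AveragedNS arXiv:1402.0290 §1.1 p.8 fn, §4 Lemma 4.1(v), (4.3), Thm 4.2, CheskidovDaiFriedlander2023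 arXiv:2209.10203 §3.2.1, §3.4 (not in print for signed circuits), EscauriazaSereginSverak2003 Thms 1.3-1.4 / Seregin2012 arXiv:1104.3615 Thm 1.1 (the PDE statement modelled), BarbatoMorandinRomito2014Dyadic arXiv:1403.2852 Thm 5
[crux] DYADIC ESS / TRACE THEOREM (tier (b) of the route, the tier Tao's footnote literally asks
about, at the ODE level): for EVERY lam>1 and EVERY Tao circuit (m, coeff symmetric +
cyclic-cancelling, class (4.3), α=2/5), a solution on [0,T) with no modes below n=0 (Lemma 4.1(v)
normalisation), continuous on [0,T), a-priori H¹⁰-regular on compact sub-intervals (sup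
lam^{4n}|X_{i,n}| < ∞ on [0,T'], T'<T; weight lam^{4n} = N_n^{10}, N_n = lam^{2n/5}) and with
BOUNDED ℓ³-IN-SCALE CRITICAL NORM sup_{t<T} Σ_{n,i} (lam^{n/5}|X_{i,n}(t)|)³ ≤ M (the L³ analogue)
does NOT blow up at T (sup_{[0,T)} lam^{4n}|X_{i,n}| < ∞, hence extends). Expected TRUE, by a soft
argument unavailable at the PDE level without fine structure: blow-up needs a front of critical
amplitude ≥ δ₀(circuit) marching to n=∞ in finite time (small critical amplitude is self-improving
under dissipation lam^{4n/5}); residuals left behind decay only by a bounded factor (elapsed time ×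
rate = O(1): 'frozen trail'), so ℓ³-boundedness forces post-front residual fractions ρ_j → 0;
recentering at the front and passing to the limit gives a solution entering the forward-invariant
subspace {X_{≤−1} = 0} in finite time with X_{−1} ≢ -/
@[route_item "route-NavierStokesRegularity-PerpetualPump"]
def CircuitTrace : Prop :=
  ∀ lam : ℝ, 1 < lam → ∀ (m : ℕ) (coeff : Fin m → Fin m → Fin m → Option (Fin 3) → ℝ), (∀ (i₁ i₂ i₃ : Fin m) (μ : Option (Fin 3)), coeff i₁ i₂ i₃ μ = coeff i₂ i₁ i₃ (Option.map (Equiv.swap (0 : Fin 3) 1) μ)) → (∀ (v : Fin 3 → Fin m) (μ : Option (Fin 3)), ∑ σ : Equiv.Perm (Fin 3), coeff (v (σ 0)) (v (σ 1)) (v (σ 2)) (Option.map σ.symm μ) = 0) → ∀ T : ℝ, 0 < T → ∀ X : Fin m → ℤ → ℝ → ℝ, let F : Fin m → ℤ → ℝ → ℝ := fun (i : Fin m) (n : ℤ) (t : ℝ) => -(lam ^ ((4 / 5 : ℝ) * n)) * X i n t + ∑ i₁ : Fin m, ∑ i₂ : Fin m, ∑ μ : Option (Fin 3), coeff i₁ i₂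 i μ * lam ^ ((n : ℝ) - (if μ = some 2 then 1 else 0)) * X i₁ (n + ((if μ = some 0 then 1 else 0) - (if μ = some 2 then 1 else 0))) t * X i₂ (n + ((if μ = some 1 then 1 else 0) - (if μ = some 2 then 1 else 0))) t; (∀ (i : Fin m) (n : ℤ), ContinuousOn (X i n) (Set.Ico 0 T)) → (∀ (i : Fin m) (n : ℤ), ∀ t ∈ Set.Ioo 0 T, HasDerivAt (X i n) (F i n t) t) → (∀ (i : Fin m) (n : ℤ) (t : ℝ), n < 0 → X i n t = 0) → (∀ T' ∈ Set.Ioo 0 T, ∃ C : ℝ, ∀ (i : Fin m) (n : ℤ), ∀ t ∈ Set.Icc 0 T', lam ^ ((4 : ℝ) * n) * |X i n t| ≤ C) → (∃ M : ℝ, ∀ t ∈ Set.Ico 0 T, ∀ s : Finset ℤ, ∑ n ∈ s, ∑ i : Fin m, (lam ^ ((1 / 5 : ℝ) * n) * |X i n t|) ^ 3 ≤ M) → ∃ C : ℝ, ∀ (i : Fin m) (n : ℤ), ∀ t ∈ Set.Ico 0 T, lam ^ ((4 : ℝ) * n) * |X i n t| ≤ C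

/-- item stmt-NavierStokesRegularity-1837 · crux · rank 5 · closed · moot by None · by planner
why it might fail: The anonymous CircuitPump witness carries no stability, so the transfer re-proves the pump for the EXACTLY lifted Volterra chain (kernel Re⟨e^{τΔ}ψ,ψ⟩ instead of e^{-ντ}): a threshold classification with memory (stub_liftPump); the low-mode truncation à la Prop 5.1 must keep the Type-I fibre sum.
sources: Tao2016AveragedNS arXiv:1402.0290 Def 3.1, Thm 3.2, §4 Lemma 4.1(iii)-(v), Thm 4.2, §5.2 Prop 5.1 + p.26, tree Literature.Analysis.FluidPDE.TaoCascadeDuhamel (modeCoeff_eq_modeScalarX, modeProjection_eq_duhamelModeField), TaoAveragedCascadeHolds (localCascade_isAveraged_holds), Theorems/Thesis/Negative/CascadeReduction.lean p83406; Theorems/PerpetualPumpPumpTransferModeCoeffOfBandField.lean p87248; Cruxes/PumpTransfer/PICKED.md (4 synthesis stubs + stub_liftPump), TRIAGE-r1-1/r1-2, AlbrittonBarker2019 arXiv:1811.00502 Thm 1.1 (blow-down + persistence of singularities as the alternative transfer), Literature.Barriers.NavierStokesRegularity.TruncatedDyadicBlowup (audit: PDE transfer is not a corollary of the ODE statement),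 CampolinaSimonnetThalabard2025 arXiv:2501.07377; Mailybaev2013 arXiv:1210.2494 (non-unique/unstable blow-up profiles)
[crux] TRANSFER ODE ⇒ PDE (card P2): CircuitPump → AveragedTypeIBlowup (both inlined). Route: take
the circuit with lam = (1+ε₀)^{5/2}, ε₀ ≤ the absolute constant of Tao2016AveragedNS Thm 3.2
(CircuitPump supplies arbitrarily fine lam), realise it as a symmetric local cascade operator C (Def
3.1, (4.1): ψ_i Schwartz, Fourier support in disjoint balls ±B_i ⊂ {1 < |ξ| ≤ 1+ε₀/2},
L²-normalised), which is an averaged Euler operator by Thm 3.2 (complex Hermitian symbols — hence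
the honest class Tao2016.AveragingDatum, not the deprecated real-symbol prelude) with cancellation
from (cyclic); start the DSS chain at scale n₀ with datum on the orbit (finite energy, Schwartz:
finitely many modes) as in Prop 5.1; then show the PDE solution shadows the ODE orbit up to the
blow-up time with the Type-I rate. The new difficulty versus Tao §4-6: at the Type-I rate
dissipation is O(1)-relevant, so the inexact diagonalisation of Δ on ψ_{i,n} (Lemma 4.1 (iii)-(iv):
O((1+ε₀)^{2n}E^{1/2}_{i,n}) errors and the energy defect) is an O(ε₀) perturbation of an O(1) effect
— needs STRUCTURAL STABILITY (hyperbolicity modulo scaling) of the DSS orbit, plus control of the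
low-mode truncation (the ancient chain's -/
@[route_item "route-NavierStokesRegularity-PerpetualPump"]
def PumpTransfer : Prop :=
  (∀ lam₀ : ℝ, 1 < lam₀ → ∃ lam : ℝ, 1 < lam ∧ lam < lam₀ ∧ ∃ (m : ℕ) (coeff : Fin m → Fin m → Fin m → Option (Fin 3) → ℝ) (k : ℕ) (X : Fin m → ℤ → ℝ → ℝ), let F : Fin m → ℤ → ℝ → ℝ := fun (i : Fin m) (n : ℤ) (t : ℝ) => -(lam ^ ((4 / 5 : ℝ) * n)) * X i n t + ∑ i₁ : Fin m, ∑ i₂ : Fin m, ∑ μ : Option (Fin 3), coeff i₁ i₂ i μ * lam ^ ((n : ℝ) - (if μ = some 2 then 1 else 0)) * X i₁ (n + ((if μ = some 0 then 1 else 0) - (if μ = some 2 then 1 else 0))) t * X i₂ (n + ((if μ = some 1 then 1 else 0) - (if μ = some 2 then 1 else 0))) t; (∀ (i₁ i₂ i₃ : Fin m) (μ : Option (Fin 3)), coeff i₁ i₂ i₃ μ = coeff i₂ i₁ i₃ (Option.map (Equiv.swap (0 : Fin 3) 1) μ)) ∧ (∀ (v : Fin 3 → Fin m) (μ : Option (Fin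 3)), ∑ σ : Equiv.Perm (Fin 3), coeff (v (σ 0)) (v (σ 1)) (v (σ 2)) (Option.map σ.symm μ) = 0) ∧ 1 ≤ k ∧ (∀ (i : Fin m) (n : ℤ) (t : ℝ), t < 0 → HasDerivAt (X i n) (F i n t) t) ∧ (∀ (i : Fin m) (n : ℤ) (t : ℝ), t < 0 → X i (n + k) (lam ^ (-((4 / 5 : ℝ) * k)) * t) = lam ^ (-((1 / 5 : ℝ) * k)) * X i n t) ∧ (∃ C : ℝ, ∀ (i : Fin m) (n : ℤ) (t : ℝ), t < 0 → lam ^ ((3 / 5 : ℝ) * n) * |X i n t| ≤ C / Real.sqrt (-t)) ∧ (∃ (i : Fin m) (n : ℤ) (t : ℝ), t < 0 ∧ X i n t ≠ 0)) → (∃ 𝒜 : Literature.Analysis.FluidPDE.Tao2016.AveragingDatum, 𝒜.IsSymmetric ∧ 𝒜.HasCancellation ∧ ∃ u₀ : SchwartzMap (EuclideanSpace ℝ (Fin 3)) (EuclideanSpace ℝ (Fin 3)), Literature.Analysis.FluidPDE.VectorCalculus.IsDivFree ⇑u₀ ∧ ∃ T : ℝ, 0 < T ∧ ∃ u : ℝ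 → Literature.Analysis.FluidPDE.Tao2016.L2C, 𝒜.IsMildSolution (Literature.Analysis.FluidPDE.Tao2016.schwartzL2 u₀) (Set.Ico 0 T) u ∧ (∃ M : ℝ, ∀ t ∈ Set.Ico 0 T, MeasureTheory.eLpNorm (u t) ⊤ MeasureTheory.volume ≤ ENNReal.ofReal (M / Real.sqrt (T - t))) ∧ ¬ ∃ T' : ℝ, T < T' ∧ ∃ v : ℝ → Literature.Analysis.FluidPDE.Tao2016.L2C, 𝒜.IsMildSolution (Literature.Analysis.FluidPDE.Tao2016.schwartzL2 u₀) (Set.Ico 0 T') v ∧ ∀ t ∈ Set.Ico 0 T, v t = u t)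

/-- item stmt-NavierStokesRegularity-0056 · crux · rank 6 · open · by planner
why it might fail: No theorem bounds an NS blow-up rate from above; averaging-insensitive methods cannot prove it (Tao's averaged blow-up is Type II); a Type-II singularity from Schwartz data (e.g. a Hou-type scenario) refutes it = ¬Clay(A); known: Leray lower bound, L³→∞, triple-log gains.
sources: Tao2016AveragedNS arXiv:1402.0290 §1.1 p.8 + footnote (Thm 1.5 witness is Type II), KochNadirashviliSereginSverak2009 arXiv:0709.3599 p.4 (Type I vs Type II), Seregin2012 arXiv:1104.3615 Thm 1.1 (L³→∞; no rate from above), Tao2021QuantitativeNS arXiv:1908.04958 Thm 1.4, Hou2022PotentiallySingularNS arXiv:2107.06509, Literature.Barriers.NavierStokesRegularity.TaoAveragedBlowup; Literature.Barriers.NavierStokesRegularity.TruncatedDyadicBlowup (critical_blowup: catalogued witnesses are Type II)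
If a finite-energy classical solution from a rapidly decaying datum has maximal lifespan T<∞ (no
classical extension past T), then ‖u(t)‖_∞ ≤ C (T−t)^{-1/2} eventually as t↑T (Leray's rate is the
matching lower bound, leray_blowup_rate_top). The hardest and most informative crux: a
counterexample is a Type II singularity, i.e. ¬(Clay A). Known: lower bound c√ν (T−t)^{-1/2} (Leray
1934 §20); L³ must blow up (ESS 2003, Seregin 2012); only triple-log quantitative gain (Tao 2021). -/
@[route_item "route-NavierStokesRegularity-PerpetualPump"]
def NoTypeII : Prop :=
  ∀ (ν T : ℝ), 0 < ν → 0 < T → ∀ (u : ℝ → EuclideanSpace ℝ (Fin 3) → EuclideanSpace ℝ (Fin 3)) (p : ℝ → EuclideanSpace ℝ (Fin 3) → ℝ), Literature.Analysis.FluidPDE.IsMaximalSmoothSolution ν 0 u p T → Literature.Analysis.FluidPDE.IsLerayHopfOn T ν 0 (u 0) u → Literature.Analysis.FluidPDE.HasRapidSpatialDecay (u 0) → Literature.Analysis.FluidPDE.IsTypeIBlowup u T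

/-- item stmt-NavierStokesRegularity-1838 · crux · rank 9 · closed · proved by Summit.NavierStokesRegularity.NavierStokesRegularity.Theorems.perpetualPump_eulerTypeIGlue_proof (prover) · by planner
why it might fail: Only by solution-concept mismatch: classical Leray–Hopf ↔ Tao's Fourier-side H¹⁰_df mild solution of the Euler datum (Duhamel with Bochner forms, pressure elimination, H¹⁰ persistence), ν-scaling; cheapest line uses Thesis as an H¹⁰⊂L^∞ bound + the PROVED hasSmoothExtensionPast_of_bounded_holds.
sources: Tao2016AveragedNS arXiv:1402.0290 §1.1 (1.3)-(1.5), (1.13), (1.15), p.7; euler datum = B (p.6), Tao2011 arXiv:1108.1165 §5 Thm 31 (LWP in H^1(R^3)), Cor. max-cauchy, tree PROVED (Literature.Analysis.FluidPDE): kato_local_holds, kato_unique_holds, weak_strong_uniqueness_holds, lemarieRieusset_singular_point_of_blowup_holds, hasSmoothExtensionPast_of_bounded_holds, nsRescale_holds; Tao2016.AveragingDatum.euler_form/euler_isSymmetric/euler_hasCancellation, Theorems/PerpetualPumpEulerTypeIGlue{FourierL2, FourierDeriv, FourierIterated, Duhamel p84948, TripleProduct p85259, HeatPairing p85474, SobolevR3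 p85321, TrilinearPrep p85423, Density p86578}.lean (toolkits, --supports 1838), Cruxes/EulerTypeIGlue/Ideas (bounded-pullback: extends_of_H10_shadow, Sketch rc0), RobinsonRodrigoSadowski2016 Thm 8.17/8.19; LemarieRieusset2016 Thm 15.1; Kato1984; FujitaKato1964
[support] EULER-DATUM GLUE: Thesis → NoTypeIClay, where NoTypeIClay := ∀ ν T>0 ∀ u p, classical NS
on [0,T) (IsClassicalNSSolutionOn), Leray–Hopf from its datum, rapidly decaying datum, IsTypeIBlowup
u T → HasSmoothExtensionPast ν 0 u T (the shape of TypeILiouville's stmt-0058 with (L) replaced by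
Thesis). Solution-concept bookkeeping, standard but not in tree: (1) ν ↦ 1 by u(t,x) ↦
ν^{-1}u(ν^{-1}t, x)… (parabolic scaling, cf.
Literature.Analysis.FluidPDE.IsClassicalNSSolutionOn.nsRescale); (2) a classical Leray–Hopf solution
from a Schwartz datum is an H¹⁰_df mild solution of ∂ₜu = Δu + B(u,u) for the Euler datum
(Tao2016.AveragingDatum.euler, euler_form = eulerForm (1.3); Plancherel identification of the
Fourier trilinear form with −⟨P[(u·∇)u], w⟩; H^k persistence for strong solutions); (3)
IsTypeIBlowup (eventual pointwise rate) + boundedness of H¹⁰ ⊂ L^∞ mild solutions on [0,T−δ] give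
the eLpNorm-∞ bound M/√(T−t) on all of [0,T); (4) Thesis gives a mild H¹⁰ extension v on [0,T')
agreeing with u; parabolic regularity (Tao's Lemma 1.3-type equivalence of the smooth and mild H¹⁰
theories; Tao 2013 arXiv:1108.1165 §§4-5) upgrades v to a classical (u',p') on [0,T') agreeing with
u o -/
@[route_item "route-NavierStokesRegularity-PerpetualPump"]
def EulerTypeIGlue : Prop :=
  (∀ 𝒜 : Literature.Analysis.FluidPDE.Tao2016.AveragingDatum, 𝒜.IsSymmetric → 𝒜.HasCancellation → ∀ u₀ : SchwartzMap (EuclideanSpace ℝ (Fin 3)) (EuclideanSpace ℝ (Fin 3)), Literature.Analysis.FluidPDE.VectorCalculus.IsDivFree ⇑u₀ → ∀ T : ℝ, 0 < T → ∀ u : ℝ → Literature.Analysis.FluidPDE.Tao2016.L2C, 𝒜.IsMildSolution (Literature.Analysis.FluidPDE.Tao2016.schwartzL2 u₀) (Set.Ico 0 T) u → (∃ M : ℝ, ∀ t ∈ Set.Ico 0 T, MeasureTheory.eLpNorm (u t) ⊤ MeasureTheory.volume ≤ ENNReal.ofReal (M / Real.sqrt (T - t))) → ∃ T' : ℝ,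 T < T' ∧ ∃ v : ℝ → Literature.Analysis.FluidPDE.Tao2016.L2C, 𝒜.IsMildSolution (Literature.Analysis.FluidPDE.Tao2016.schwartzL2 u₀) (Set.Ico 0 T') v ∧ ∀ t ∈ Set.Ico 0 T, v t = u t) → (∀ (ν T : ℝ), 0 < ν → 0 < T → ∀ (u : ℝ → EuclideanSpace ℝ (Fin 3) → EuclideanSpace ℝ (Fin 3)) (p : ℝ → EuclideanSpace ℝ (Fin 3) → ℝ), Literature.Analysis.FluidPDE.IsClassicalNSSolutionOn (Set.Ico 0 T) ν 0 u p → Literature.Analysis.FluidPDE.IsLerayHopfOn T ν 0 (u 0) u → Literature.Analysis.FluidPDE.HasRapidSpatialDecay (u 0) → Literature.Analysis.FluidPDE.IsTypeIBlowup u T → Literature.Analysis.FluidPDE.HasSmoothExtensionPast ν 0 u T)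

/-- item stmt-NavierStokesRegularity-0055 · support · rank 9 · closed · proved by Summit.NavierStokesRegularity.NavierStokesRegularity.Theorems.typeICertificateLadder_noBlowupToClay_proof @ f501e9774e4d (prover) · by planner
Given NoBlowup, build the Clay (A) solution: local finite-energy classical solution for smooth
divergence-free rapidly decaying data (Leray 1934 §III / Fujita–Kato 1964 + LPS smoothing), continue
past every T using NoBlowup, glue by weak–strong uniqueness (Prodi–Serrin), bounded energy from the
energy inequality, and convert with
Literature.Analysis.FluidPDE.isNavierStokesSolution_and_smooth_iff. Blow-up at spatial infinity is
excluded by CKN ε-regularity applied far out. May take named Literature facts (leray_existence_R3,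
ladyzhenskaya_prodi_serrin, weak_strong_uniqueness, fujita_kato_local) as hypotheses if the grounder
so rules. -/
@[route_item "route-NavierStokesRegularity-PerpetualPump"]
def NoBlowupToClay : Prop :=
  (∀ (ν T : ℝ), 0 < ν → 0 < T → ∀ (u : ℝ → EuclideanSpace ℝ (Fin 3) → EuclideanSpace ℝ (Fin 3)) (p : ℝ → EuclideanSpace ℝ (Fin 3) → ℝ), Literature.Analysis.FluidPDE.IsClassicalNSSolutionOn (Set.Ico 0 T) ν 0 u p → Literature.Analysis.FluidPDE.IsLerayHopfOn T ν 0 (u 0) u → Literature.Analysis.FluidPDE.HasRapidSpatialDecay (u 0) → Literature.Analysis.FluidPDE.HasSmoothExtensionPast ν 0 u T) → NavierStokesRegularity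

/-- `NoBlowupToClay` holds: proved by `Summit.NavierStokesRegularity.NavierStokesRegularity.Theorems.typeICertificateLadder_noBlowupToClay_proof` @ f501e9774e4d. -/
theorem NoBlowupToClay_holds : NoBlowupToClay := _root_.Summit.NavierStokesRegularity.NavierStokesRegularity.Theorems.typeICertificateLadder_noBlowupToClay_proof

/-- item stmt-NavierStokesRegularity-14766 · support · rank 9 · closed · proved by Summit.NavierStokesRegularity.NavierStokesRegularity.Theorems.perpetualPump_thesisIffNoAveragedTypeIBlowup_proof (prover) · by planner
[support] GLUE (route-repair, unused-crux): the target `Thesis` (the `closes` hypothesis) is EXACTLY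
the non-existence of the PDE perpetual pump: Thesis ↔ ¬AveragedTypeIBlowup (classical logic; already
kernel-checked in tree as `Theorems.AveragedTypeIBlowup.Negative.averagedTypeIBlowup_iff_not_thesis
: AveragedTypeIBlowup ↔ ¬ Thesis`, NSReduction.lean; re-derived in the planner's Sketch.lean, rc0).
POLARITY — read before staffing: deciding crux #3 AveragedTypeIBlowup EITHER WAY decides the
hypothesis Thesis: REFUTED (¬AveragedTypeIBlowup by name) ⇒ Thesis ⇒ `closes` fires with
EulerTypeIGlue + NoTypeII + NoBlowupToClay; PROVED ⇒ ¬Thesis ⇒ route-item-refuted, the route is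
BROKEN by design and closes `refuted:Thesis` as a new barrier theorem (KILL CRITERIA). So this item
connects the route's negative programme (CircuitPump → PumpTransfer → AveragedTypeIBlowup, glue
PumpChain) to the closes cone without asserting that a proof of the pump proves the thesis.
Difficulty: provable-now (2 lines from the landed iff). [sources: Tao2016AveragedNS arXiv:1402.0290
§1.1 p.8 fn; NSReduction.lean (cdisprove 1835); refuter route reviews 0860cd9d / 3a2b8e1c / 0af37e19
(AveragedTypeIBlowup ↔ ¬Thesis -/
@[route_item "route-NavierStokesRegularity-PerpetualPump"]
def ThesisIffNoAveragedTypeIBlowup : Prop :=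
  Thesis ↔ ¬ AveragedTypeIBlowup

/-- item stmt-NavierStokesRegularity-14768 · support · rank 9 · closed · proved by Summit.NavierStokesRegularity.NavierStokesRegularity.Theorems.perpetualPump_pumpChain_proof (prover) · by planner
[support] GLUE (route-repair, unused-crux): the ODE perpetual pump (crux #2 CircuitPump) and the
ODE⇒PDE transfer (crux #5 PumpTransfer) compose to the PDE perpetual pump (crux #3
AveragedTypeIBlowup) — this is the route header's "Intended proof: CircuitPump + PumpTransfer".
Definitional: PumpTransfer is by construction `CircuitPump → AveragedTypeIBlowup` with both sides
inlined (PumpTransfer ↔ (CircuitPump → AveragedTypeIBlowup) is Iff.rfl; checked by three refuter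
route reviews and in the planner's Sketch.lean, rc0), so the proof is `fun hP hT => hT hP`. Together
with glue ThesisIffNoAveragedTypeIBlowup (Thesis ↔ ¬AveragedTypeIBlowup) it places CircuitPump and
PumpTransfer in the cone of the `closes` hypothesis Thesis ON ITS NEGATIVE SIDE: CircuitPump ∧
PumpTransfer ⇒ AveragedTypeIBlowup ⇒ ¬Thesis (route broken by design, new barrier theorem);
¬CircuitPump (an ODE abstract Liouville theorem) is evidence for Thesis, not a proof. Difficulty:
provable-now (one line). [sources: Tao2016AveragedNS arXiv:1402.0290 Thm 3.2, §4 (4.3), §5.2 Prop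
5.1; refuter route reviews 0860cd9d / 3a2b8e1c / 0af37e19] -/
@[route_item "route-NavierStokesRegularity-PerpetualPump"]
def PumpChain : Prop :=
  CircuitPump → PumpTransfer → AveragedTypeIBlowup

/-- item stmt-NavierStokesRegularity-14796 · support · rank 9 · closed · proved by Summit.NavierStokesRegularity.NavierStokesRegularity.Theorems.perpetualPump_thesisOfNoAveragedTypeIBlowup_proof @ a66d58d054bb (prover) · by planner
[support] GLUE (route-repair, unused-crux): refuting the PDE perpetual pump proves the target —
¬AveragedTypeIBlowup → Thesis (classical logic: Thesis is EXACTLY ¬AveragedTypeIBlowup; the converse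
direction AveragedTypeIBlowup → ¬Thesis is already kernel-checked in tree as
`Theorems.AveragedTypeIBlowup.Negative.averagedTypeIBlowup_iff_not_thesis`, NSReduction.lean; both
directions re-derived in the planner's Sketch.lean, rc0). This is the cone edge AveragedTypeIBlowup
⟶ Thesis of the `closes` hypothesis Thesis, ON THE NEGATIVE SIDE. POLARITY — read before staffing:
crux #3 AveragedTypeIBlowup REFUTED (¬AveragedTypeIBlowup by name) ⇒ Thesis ⇒ `closes` fires with
EulerTypeIGlue + NoTypeII + NoBlowupToClay; AveragedTypeIBlowup PROVED (intended via CircuitPump +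
PumpTransfer, glue PumpChain) ⇒ ¬Thesis in two lines ⇒ route-item-refuted, the route is BROKEN by
design and closes `refuted:Thesis` as a new barrier theorem (KILL CRITERIA). A views 'derived/leaf'
chip showing AveragedTypeIBlowup under the Thesis slot must be read with this polarity. Supersedes
the ↔-form item ThesisIffNoAveragedTypeIBlowup (stmt-14766, not parsed as a cone edge; dropped).
Difficulty: provable-now (3 lines: by -/
@[route_item "route-NavierStokesRegularity-PerpetualPump"]
def ThesisOfNoAveragedTypeIBlowup : Prop :=
  ¬ AveragedTypeIBlowup → Thesis

/-- item stmt-NavierStokesRegularity-1833 · assembly · rank 1 · closed · proved by Summit.NavierStokesRegularity.NavierStokesRegularity.Theorems.perpetualPump_assembly_proof @ 3a6dad086717 (prover) · by planner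
[assembly] Thesis → EulerTypeIGlue → NoTypeII → NoBlowupToClay → NavierStokesRegularity, where
EulerTypeIGlue := Thesis → NoTypeIClay (no Type-I blow-up for finite-energy classical solutions from
Clay data), NoTypeII = stmt-NavierStokesRegularity-0056 (shared with route TypeILiouville),
NoBlowupToClay = stmt-NavierStokesRegularity-0055 (shared local-theory assembly). PURE LOGIC, PROVED
sorry-free in the planner's Sketch.lean (assembly_holds, 7 lines): fix ν,T,u,p classical Leray–Hopf
from a rapidly decaying datum; if u has no smooth extension past T it is maximal
(IsMaximalSmoothSolution = classical ∧ ¬HasSmoothExtensionPast), NoTypeII gives IsTypeIBlowup u T,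
EulerTypeIGlue+Thesis give HasSmoothExtensionPast — contradiction; hence NoBlowup and NoBlowupToClay
yields Clay (A). [sources: Fefferman2000, KNSS2009] -/
@[route_item "route-NavierStokesRegularity-PerpetualPump"]
def Assembly : Prop :=
  (∀ 𝒜 : Literature.Analysis.FluidPDE.Tao2016.AveragingDatum, 𝒜.IsSymmetric → 𝒜.HasCancellation → ∀ u₀ : SchwartzMap (EuclideanSpace ℝ (Fin 3)) (EuclideanSpace ℝ (Fin 3)), Literature.Analysis.FluidPDE.VectorCalculus.IsDivFree ⇑u₀ → ∀ T : ℝ, 0 < T → ∀ u : ℝ → Literature.Analysis.FluidPDE.Tao2016.L2C, 𝒜.IsMildSolution (Literature.Analysis.FluidPDE.Tao2016.schwartzL2 u₀) (Set.Ico 0 T) u → (∃ M : ℝ, ∀ t ∈ Set.Ico 0 T, MeasureTheory.eLpNorm (u t) ⊤ MeasureTheory.volume ≤ ENNReal.ofReal (M / Real.sqrt (T - t))) → ∃ T' : ℝ, T < T' ∧ ∃ v : ℝ → Literature.Analysis.FluidPDE.Tao2016.L2C, 𝒜.IsMildSolution (Literature.Analysis.FluidPDE.Tao2016.schwartzL2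 u₀) (Set.Ico 0 T') v ∧ ∀ t ∈ Set.Ico 0 T, v t = u t) → ((∀ 𝒜 : Literature.Analysis.FluidPDE.Tao2016.AveragingDatum, 𝒜.IsSymmetric → 𝒜.HasCancellation → ∀ u₀ : SchwartzMap (EuclideanSpace ℝ (Fin 3)) (EuclideanSpace ℝ (Fin 3)), Literature.Analysis.FluidPDE.VectorCalculus.IsDivFree ⇑u₀ → ∀ T : ℝ, 0 < T → ∀ u : ℝ → Literature.Analysis.FluidPDE.Tao2016.L2C, 𝒜.IsMildSolution (Literature.Analysis.FluidPDE.Tao2016.schwartzL2 u₀) (Set.Ico 0 T) u → (∃ M : ℝ, ∀ t ∈ Set.Ico 0 T, MeasureTheory.eLpNorm (u t) ⊤ MeasureTheory.volume ≤ ENNReal.ofReal (M / Real.sqrt (T - t))) → ∃ T' : ℝ, T < T' ∧ ∃ v : ℝ → Literature.Analysis.FluidPDE.Tao2016.L2C, 𝒜.IsMildSolution (Literature.Analysis.FluidPDE.Tao2016.schwartzL2 u₀) (Set.Ico 0 T') v ∧ ∀ t ∈ Set.Ico 0 T, v t = u t) → (∀ (ν T : ℝ), 0 < ν → 0 < T →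 ∀ (u : ℝ → EuclideanSpace ℝ (Fin 3) → EuclideanSpace ℝ (Fin 3)) (p : ℝ → EuclideanSpace ℝ (Fin 3) → ℝ), Literature.Analysis.FluidPDE.IsClassicalNSSolutionOn (Set.Ico 0 T) ν 0 u p → Literature.Analysis.FluidPDE.IsLerayHopfOn T ν 0 (u 0) u → Literature.Analysis.FluidPDE.HasRapidSpatialDecay (u 0) → Literature.Analysis.FluidPDE.IsTypeIBlowup u T → Literature.Analysis.FluidPDE.HasSmoothExtensionPast ν 0 u T)) → (∀ (ν T : ℝ), 0 < ν → 0 < T → ∀ (u : ℝ → EuclideanSpace ℝ (Fin 3) → EuclideanSpace ℝ (Fin 3)) (p : ℝ → EuclideanSpace ℝ (Fin 3) → ℝ), Literature.Analysis.FluidPDE.IsMaximalSmoothSolution ν 0 u p T → Literature.Analysis.FluidPDE.IsLerayHopfOn T ν 0 (u 0) u → Literature.Analysis.FluidPDE.HasRapidSpatialDecay (u 0) → Literature.Analysis.FluidPDE.IsTypeIBlowup u T) → ((∀ (ν T : ℝ), 0 < ν → 0 < T → ∀ (u : ℝ → EuclideanSpace ℝ (Fin 3) → EuclideanSpace ℝ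 (Fin 3)) (p : ℝ → EuclideanSpace ℝ (Fin 3) → ℝ), Literature.Analysis.FluidPDE.IsClassicalNSSolutionOn (Set.Ico 0 T) ν 0 u p → Literature.Analysis.FluidPDE.IsLerayHopfOn T ν 0 (u 0) u → Literature.Analysis.FluidPDE.HasRapidSpatialDecay (u 0) → Literature.Analysis.FluidPDE.HasSmoothExtensionPast ν 0 u T) → NavierStokesRegularity) → NavierStokesRegularity

end Summit.NavierStokesRegularity.NavierStokesRegularity.Theses.PerpetualPump
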